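import Mathlib
import HarnessLib
import Summits.Ventures.LatticeQCDFlow.Scaling.AutoregressivePathFaithful

/-!
# LatticeQCDFlow / Scaling — multivariate total positivity (MTP₂) is preserved by partial averages
# (Karlin–Rinott / Ahlswede–Daykin four-point step, typed in the coordinate-average language)

HONEST FRAMING: exact (Metropolis-corrected) sampling algorithms for lattice gauge theory;
figures of merit are autocorrelation/cost numbers at stated couplings and volumes; no
continuum-physics claim.

Venture `LatticeQCDFlow` (cell pub-lqcd), topic `Scaling`, FANOUT row 30 (lean-1, GEN-17) — OUR WORK,
the mechanism that THEORY-2 §4 C5 needs in `d ≥ 2` (named as 'not claimed' in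
`Scaling/KernelCompositionTP2`): on a product of linearly ordered coordinates a non-negative weight
`f` is MTP₂ (multivariate totally positive of order two; the FKG lattice condition) when
`f(x) f(y) ≤ f(x ∨ y) f(x ∧ y)` for the coordinatewise max / min.  Products of MTP₂ weights are MTP₂
(trivial), every nearest-neighbour ferromagnetic (TP₂-bond) weight is MTP₂, and — the point of this
file — INTEGRATING OUT COORDINATES KEEPS MTP₂:

* §1 **`fourPoint_le`** — the pointwise four-point step: for `a, b, U, V ≥ 0` with `a ≤ U`, `b ≤ U`,
  `a·b ≤ U·V` one has `a + b ≤ U + V`; and **`mtp2_integrand_le`**: if `F : (κ → X) → X → ℝ` is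
  jointly MTP₂ and non-negative then for all `x, y, s, t`
  `F x s·F y t + F x t·F y s ≤ F (x⊔y) s·F (x⊓y) t + F (x⊔y) t·F (x⊓y) s`.
* §2 **`mtp2_integral`** — integrating the last argument of a jointly MTP₂ non-negative `F` with
  integrable sections against any measure gives an MTP₂ function `x ↦ ∫ F x t dμ(t)` (Fubini for
  products of integrals + §1).
* §3 **`mtp2_coordAvg_singleton`**, **`mtp2_coordAvg`** — in the tree's language: for a bounded
  measurable non-negative MTP₂ weight `w` on `κ → X` and any reference probability measure, every
  partial average `A_s w = Exactness.coordAvg μ s w` is MTP₂ (one coordinate: `update` commutes with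
  `⊔`, `⊓`; a block: the measurable tower `coordAvg_insert_of_bounded` of
  `Scaling/AutoregressivePathFaithful`, induction on `s`).
* §4 `mtp2_mul` (products), `mtp2_of_pairBond` (a TP₂ two-body factor `b(x i, x j)` is MTP₂ as a
  weight on `κ → X`), `mtp2_of_oneBody` (one-body factors are MTP₂); §5 `mtp2_finset_prod`,
  **`mtp2_pairBondWeight`** (every ferromagnetic pair-interaction weight on any graph is MTP₂) and
  **`mtp2_coordAvg_pairBondWeight`** (so are all its partial averages).

READING (value-free, C5): the numerator and denominator of every exact autoregressive conditional of a
ferromagnetic nearest-neighbour field (gradient φ⁴, Gaussian, Ising-type pair interactions with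
arbitrary one-body terms) are MTP₂ in the retained variables, in every dimension and every order — the
qualitative half of faithfulness through the block; the STRICT inequality along a connected integrated
path (what 'the fill edge is read' needs) is NOT CLAIMED here (one dimension: `KernelCompositionTP2`).
Literature grade (cell rule): known mechanism [Karlin–Rinott 1980, J. Multivariate Anal. 10, Prop. 3.2–3.4;
Ahlswede–Daykin 1978; the discrete form is the tree's `Literature/Combinatorics/Sahi2008/Marginals`] —
typed here for integrals; nothing is cited as a fact; no `def`; no `sorry`.
-/

noncomputable section

namespace Summit.Ventures.LatticeQCDFlow.Theory2.Autoregressive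

open MeasureTheory Function Set
open Summit.Ventures.LatticeQCDFlow.Exactness

/-! ## §1 The four-point step -/

/-- **The four-point step**: `a, b ≤ U`, `a·b ≤ U·V`, everything non-negative ⇒ `a + b ≤ U + V`
(`(U − a)(U − b) ≥ 0` gives `U² + ab ≥ (a+b)U`, and `ab ≤ UV`). [folklore: Ahlswede–Daykin] -/
theorem fourPoint_le {a b U V : ℝ} (ha : 0 ≤ a) (hb : 0 ≤ b) (hV : 0 ≤ V) (haU : a ≤ U) (hbU : b ≤ U)
    (habUV : a * b ≤ U * V) : a + b ≤ U + V := by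
  rcases eq_or_lt_of_le (le_trans ha haU) with hU | hU
  · -- `U = 0`: then `a = b = 0`
    have ha0 : a = 0 := le_antisymm (hU ▸ haU) ha
    have hb0 : b = 0 := le_antisymm (hU ▸ hbU) hb
    rw [ha0, hb0, ← hU]; simpa using hV
  · have h1 : 0 ≤ (U - a) * (U - b) := mul_nonneg (sub_nonneg.2 haU) (sub_nonneg.2 hbU)
    nlinarith

variable {κ : Type*} {X : Type*} [LinearOrder X]

/-- **The MTP₂ integrand inequality**: for `F : (κ → X) → X → ℝ` non-negative and jointly MTP₂
(`F x s · F y t ≤ F (x ⊔ y) (max s t) · F (x ⊓ y) (min s t)`), for all `x, y, s, t`: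
`F x s·F y t + F x t·F y s ≤ F (x⊔y) s·F (x⊓y) t + F (x⊔y) t·F (x⊓y) s`. [folklore: Karlin–Rinott] -/
theorem mtp2_integrand_le (F : (κ → X) → X → ℝ) (hF0 : ∀ x s, 0 ≤ F x s)
    (hF : ∀ x y s t, F x s * F y t ≤ F (x ⊔ y) (max s t) * F (x ⊓ y) (min s t)) (x y : κ → X)
    (s t : X) :
    F x s * F y t + F x t * F y s ≤ F (x ⊔ y) s * F (x ⊓ y) t + F (x ⊔ y) t * F (x ⊓ y) s := by
  -- reduce to `s ≤ t` by symmetry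
  wlog hst : s ≤ t generalizing s t
  · have h := this t s (le_of_lt (not_le.1 hst))
    linarith
  have hmax : max s t = t := max_eq_right hst
  have hmin : min s t = s := min_eq_left hst
  have hmax' : max t s = t := max_eq_left hst
  have hmin' : min t s = s := min_eq_right hst
  -- `U = F(x⊔y) t · F(x⊓y) s`, `V = F(x⊔y) s · F(x⊓y) t`
  have hU1 : F x s * F y t ≤ F (x ⊔ y) t * F (x ⊓ y) s := by
    have h := hF y x t s
    rw [hmax', hmin', sup_comm, inf_comm] at h
    linarith [h]
  have hU2 : F x t * F y s ≤ F (x ⊔ y) t * F (x ⊓ y) s := by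
    have h := hF x y t s
    rw [hmax', hmin'] at h
    exact h
  -- fixed second coordinate: `F x s F y s ≤ F(x⊔y) s F(x⊓y) s`, same at `t`
  have hs : F x s * F y s ≤ F (x ⊔ y) s * F (x ⊓ y) s := by
    have h := hF x y s s
    rwa [max_self, min_self] at h
  have ht : F x t * F y t ≤ F (x ⊔ y) t * F (x ⊓ y) t := by
    have h := hF x y t t
    rwa [max_self, min_self] at h
  have hab : (F x s * F y t) * (F x t * F y s) ≤
      (F (x ⊔ y) t * F (x ⊓ y) s) * (F (x ⊔ y) s * F (x ⊓ y) t) := by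
    calc (F x s * F y t) * (F x t * F y s) = (F x s * F y s) * (F x t * F y t) := by ring
      _ ≤ (F (x ⊔ y) s * F (x ⊓ y) s) * (F (x ⊔ y) t * F (x ⊓ y) t) :=
          mul_le_mul hs ht (mul_nonneg (hF0 _ _) (hF0 _ _)) (mul_nonneg (hF0 _ _) (hF0 _ _))
      _ = (F (x ⊔ y) t * F (x ⊓ y) s) * (F (x ⊔ y) s * F (x ⊓ y) t) := by ring
  have h := fourPoint_le (mul_nonneg (hF0 _ _) (hF0 _ _)) (mul_nonneg (hF0 _ _) (hF0 _ _))
    (mul_nonneg (hF0 _ _) (hF0 _ _)) hU1 hU2 hab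
  linarith

/-! ## §2 Integrating one argument keeps MTP₂ -/

variable [MeasurableSpace X]

/-- **INTEGRATING THE LAST ARGUMENT OF A JOINTLY MTP₂ NON-NEGATIVE FUNCTION GIVES AN MTP₂ FUNCTION**:
`(∫ F x)(∫ F y) ≤ (∫ F (x⊔y))(∫ F (x⊓y))` (products of integrals as integrals over `μ ⊗ μ`,
then `mtp2_integrand_le` pointwise). [folklore: Karlin–Rinott 1980 Prop. 3.2; typed here] -/
theorem mtp2_integral (μ : Measure X) [SFinite μ] (F : (κ → X) → X → ℝ) (hF0 : ∀ x s, 0 ≤ F x s)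
    (hF : ∀ x y s t, F x s * F y t ≤ F (x ⊔ y) (max s t) * F (x ⊓ y) (min s t))
    (hint : ∀ x, Integrable (F x) μ) (x y : κ → X) :
    (∫ s, F x s ∂μ) * (∫ t, F y t ∂μ) ≤ (∫ s, F (x ⊔ y) s ∂μ) * (∫ t, F (x ⊓ y) t ∂μ) := by
  have h2 : 2 * ((∫ s, F x s ∂μ) * (∫ t, F y t ∂μ)) ≤
      2 * ((∫ s, F (x ⊔ y) s ∂μ) * (∫ t, F (x ⊓ y) t ∂μ)) := by
    rw [two_mul, two_mul]
    nth_rewrite 2 [mul_comm]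
    nth_rewrite 4 [mul_comm]
    rw [← integral_prod_mul (μ := μ) (ν := μ) (F x) (F y),
      ← integral_prod_mul (μ := μ) (ν := μ) (F y) (F x),
      ← integral_prod_mul (μ := μ) (ν := μ) (F (x ⊔ y)) (F (x ⊓ y)),
      ← integral_prod_mul (μ := μ) (ν := μ) (F (x ⊓ y)) (F (x ⊔ y)),
      ← integral_add ((hint x).mul_prod (hint y)) ((hint y).mul_prod (hint x)),
      ← integral_add ((hint _).mul_prod (hint _)) ((hint _).mul_prod (hint _))]
    refine integral_mono (((hint x).mul_prod (hint y)).add ((hint y).mul_prod (hint x)))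
      (((hint _).mul_prod (hint _)).add ((hint _).mul_prod (hint _))) fun p => ?_
    have h := mtp2_integrand_le F hF0 hF x y p.1 p.2
    simp only
    linarith [h, mul_comm (F y p.1) (F x p.2), mul_comm (F (x ⊓ y) p.1) (F (x ⊔ y) p.2)]
  linarith

/-! ## §3 Partial averages of MTP₂ weights are MTP₂ -/

section CoordAvg

variable [Fintype κ] [DecidableEq κ] (μ : Measure X) [IsProbabilityMeasure μ]

omit [MeasurableSpace X] [Fintype κ] in
/-- `update` commutes with the coordinatewise `⊔`. [folklore] -/
theorem update_sup_update (x y : κ → X) (k : κ) (s t : X) :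
    update x k s ⊔ update y k t = update (x ⊔ y) k (max s t) := by
  funext i
  by_cases hi : i = k
  · subst hi; simp
  · simp [update_of_ne hi]

omit [MeasurableSpace X] [Fintype κ] in
/-- `update` commutes with the coordinatewise `⊓`. [folklore] -/
theorem update_inf_update (x y : κ → X) (k : κ) (s t : X) :
    update x k s ⊓ update y k t = update (x ⊓ y) k (min s t) := by
  funext i
  by_cases hi : i = k
  · subst hi; simp
  · simp [update_of_ne hi]

/-- **Averaging ONE coordinate of an MTP₂ weight gives an MTP₂ weight** (bounded measurable
non-negative `w`, any reference probability measure). [ours] -/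
theorem mtp2_coordAvg_singleton (k : κ) {w : (κ → X) → ℝ} (hwm : Measurable w) (hw0 : ∀ x, 0 ≤ w x)
    {C : ℝ} (hwC : ∀ x, |w x| ≤ C) (hw : ∀ x y, w x * w y ≤ w (x ⊔ y) * w (x ⊓ y))
    (x y : κ → X) :
    coordAvg μ {k} w x * coordAvg μ {k} w y ≤
      coordAvg μ {k} w (x ⊔ y) * coordAvg μ {k} w (x ⊓ y) := by
  simp only [coordAvg_singleton_of_measurable μ k hwm]
  refine mtp2_integral μ (fun x s => w (update x k s)) (fun x s => hw0 _) (fun x y s t => ?_)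
    (fun x => ?_) x y
  · rw [← update_sup_update, ← update_inf_update]; exact hw _ _
  · exact Integrable.mono' (integrable_const C)
      ((hwm.comp (measurable_update x)).aestronglyMeasurable)
      (ae_of_all _ fun s => by rw [Real.norm_eq_abs]; exact hwC _)

omit [LinearOrder X] in
/-- A partial average of a bounded measurable non-negative weight is bounded, measurable in the sense
needed for the tower, and non-negative (bookkeeping). [ours] -/
theorem coordAvg_singleton_props (k : κ) {w : (κ → X) → ℝ} (hwm : Measurable w) (hw0 : ∀ x, 0 ≤ w x)
    {C : ℝ} (hwC : ∀ x, |w x| ≤ C) :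
    Measurable (coordAvg μ {k} w) ∧ (∀ x, 0 ≤ coordAvg μ {k} w x) ∧
      ∀ x, |coordAvg μ {k} w x| ≤ C := by
  have hm : Measurable fun p : (κ → X) × (κ → X) => w (({k} : Finset κ).piecewise p.2 p.1) :=
    hwm.comp (measurable_piecewise_prod {k})
  refine ⟨(hm.stronglyMeasurable.integral_prod_right' (ν := Measure.pi fun _ : κ => μ)).measurable,
    fun x => integral_nonneg fun ω' => hw0 _, fun x => ?_⟩
  have h0C : 0 ≤ C := (abs_nonneg _).trans (hwC x)
  rw [coordAvg, abs_le]
  constructor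
  · exact le_trans (by linarith) (integral_nonneg fun ω' => hw0 _)
  · calc (∫ ω', w (({k} : Finset κ).piecewise ω' x) ∂Measure.pi fun _ : κ => μ)
        ≤ ∫ _, C ∂Measure.pi fun _ : κ => μ := by
          refine integral_mono_of_nonneg (ae_of_all _ fun _ => hw0 _) (integrable_const C)
            (ae_of_all _ fun ω' => (le_abs_self _).trans (hwC _))
      _ = C := by simp

/-- **PARTIAL AVERAGES OF MTP₂ WEIGHTS ARE MTP₂**: for every finite set `s` of integrated coordinates,
every bounded measurable non-negative MTP₂ weight `w` and every reference probability measure,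
`A_s w (x) · A_s w (y) ≤ A_s w (x ⊔ y) · A_s w (x ⊓ y)` (induction on `s` through the measurable
tower `coordAvg_insert_of_bounded`). [ours; mechanism Karlin–Rinott 1980 Prop. 3.3] -/
theorem mtp2_coordAvg (s : Finset κ) :
    ∀ {w : (κ → X) → ℝ}, Measurable w → (∀ x, 0 ≤ w x) → (∃ C, ∀ x, |w x| ≤ C) →
      (∀ x y, w x * w y ≤ w (x ⊔ y) * w (x ⊓ y)) →
      ∀ x y, coordAvg μ s w x * coordAvg μ s w y ≤ coordAvg μ s w (x ⊔ y) * coordAvg μ s w (x ⊓ y) := by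
  induction s using Finset.induction_on with
  | empty =>
    intro w _ _ _ hw x y
    simpa [coordAvg_empty] using hw x y
  | insert k s hk ih =>
    intro w hwm hw0 hwC hw x y
    obtain ⟨C, hC⟩ := hwC
    simp only [coordAvg_insert_of_bounded μ hk hwm hC]
    obtain ⟨hm1, h01, hC1⟩ := coordAvg_singleton_props μ k hwm hw0 hC
    exact ih hm1 h01 ⟨C, hC1⟩ (mtp2_coordAvg_singleton μ k hwm hw0 hC hw) x y

end CoordAvg

/-! ## §4 Sources of MTP₂ weights: products, pair bonds, one-body factors -/

omit [MeasurableSpace X] in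
/-- Products of non-negative MTP₂ weights are MTP₂. [folklore] -/
theorem mtp2_mul {w₁ w₂ : (κ → X) → ℝ} (h₁0 : ∀ x, 0 ≤ w₁ x) (h₂0 : ∀ x, 0 ≤ w₂ x)
    (h₁ : ∀ x y, w₁ x * w₁ y ≤ w₁ (x ⊔ y) * w₁ (x ⊓ y))
    (h₂ : ∀ x y, w₂ x * w₂ y ≤ w₂ (x ⊔ y) * w₂ (x ⊓ y)) (x y : κ → X) :
    (w₁ x * w₂ x) * (w₁ y * w₂ y) ≤ (w₁ (x ⊔ y) * w₂ (x ⊔ y)) * (w₁ (x ⊓ y) * w₂ (x ⊓ y)) := by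
  calc (w₁ x * w₂ x) * (w₁ y * w₂ y) = (w₁ x * w₁ y) * (w₂ x * w₂ y) := by ring
    _ ≤ (w₁ (x ⊔ y) * w₁ (x ⊓ y)) * (w₂ (x ⊔ y) * w₂ (x ⊓ y)) :=
        mul_le_mul (h₁ x y) (h₂ x y) (mul_nonneg (h₂0 _) (h₂0 _)) (mul_nonneg (h₁0 _) (h₁0 _))
    _ = _ := by ring

omit [MeasurableSpace X] in
/-- One-body factors are MTP₂ (with equality). [folklore] -/
theorem mtp2_of_oneBody (g : X → ℝ) (i : κ) (x y : κ → X) :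
    g (x i) * g (y i) ≤ g ((x ⊔ y) i) * g ((x ⊓ y) i) := by
  simp only [Pi.sup_apply, Pi.inf_apply]
  rcases le_total (x i) (y i) with h | h
  · rw [sup_eq_right.2 h, inf_eq_left.2 h, mul_comm]
  · rw [sup_eq_left.2 h, inf_eq_right.2 h]

omit [MeasurableSpace X] in
/-- **A TP₂ two-body factor is MTP₂** as a weight on `κ → X`: if
`b u' v · b u v' ≤ b u v · b u' v'` for `u ≤ u'`, `v ≤ v'` (TP₂), then `x ↦ b (x i) (x j)` satisfies the
lattice condition. [folklore] -/
theorem mtp2_of_pairBond (b : X → X → ℝ)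
    (hb : ∀ u u' v v', u ≤ u' → v ≤ v' → b u' v * b u v' ≤ b u v * b u' v') (i j : κ)
    (x y : κ → X) :
    b (x i) (x j) * b (y i) (y j) ≤ b ((x ⊔ y) i) ((x ⊔ y) j) * b ((x ⊓ y) i) ((x ⊓ y) j) := by
  simp only [Pi.sup_apply, Pi.inf_apply]
  rcases le_total (x i) (y i) with hi | hi <;> rcases le_total (x j) (y j) with hj | hj
  · rw [sup_eq_right.2 hi, inf_eq_left.2 hi, sup_eq_right.2 hj, inf_eq_left.2 hj, mul_comm]
  · rw [sup_eq_right.2 hi, inf_eq_left.2 hi, sup_eq_left.2 hj, inf_eq_right.2 hj]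
    have := hb (x i) (y i) (y j) (x j) hi hj
    linarith [mul_comm (b (x i) (x j)) (b (y i) (y j))]
  · rw [sup_eq_left.2 hi, inf_eq_right.2 hi, sup_eq_right.2 hj, inf_eq_left.2 hj]
    have := hb (y i) (x i) (x j) (y j) hi hj
    linarith
  · rw [sup_eq_left.2 hi, inf_eq_right.2 hi, sup_eq_left.2 hj, inf_eq_right.2 hj]

/-! ## §5 Ferromagnetic pair-interaction weights and their partial averages are MTP₂ -/

omit [MeasurableSpace X] in
/-- A finite product of non-negative MTP₂ weights is MTP₂ (and non-negative). [folklore] -/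
theorem mtp2_finset_prod {τ : Type*} (T : Finset τ) (f : τ → (κ → X) → ℝ)
    (h0 : ∀ c x, 0 ≤ f c x) (h : ∀ c x y, f c x * f c y ≤ f c (x ⊔ y) * f c (x ⊓ y)) :
    ∀ x y : κ → X,
      (∏ c ∈ T, f c x) * (∏ c ∈ T, f c y) ≤ (∏ c ∈ T, f c (x ⊔ y)) * ∏ c ∈ T, f c (x ⊓ y) := by
  classical
  induction T using Finset.induction_on with
  | empty => intro x y; simp
  | insert c T hc ih =>
    intro x y
    rw [Finset.prod_insert hc, Finset.prod_insert hc, Finset.prod_insert hc, Finset.prod_insert hc]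
    exact mtp2_mul (w₁ := f c) (w₂ := fun x => ∏ c ∈ T, f c x) (h0 c)
      (fun x => Finset.prod_nonneg fun c _ => h0 c x) (h c) ih x y

omit [MeasurableSpace X] in
/-- **EVERY FERROMAGNETIC PAIR-INTERACTION WEIGHT IS MTP₂**: `w(x) = ∏_i g_i(x_i) · ∏_{e ∈ E} b_e(x_{e₁}, x_{e₂})`
with non-negative one-body factors and non-negative TP₂ bonds (gradient-`φ⁴`, Gaussian, ferromagnetic
`σ`-type couplings on ANY graph, any dimension) satisfies the lattice condition. [folklore] -/
theorem mtp2_pairBondWeight {η : Type*} (E : Finset η) (src tgt : η → κ) (b : η → X → X → ℝ)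
    (g : κ → X → ℝ) [Fintype κ] (hg0 : ∀ i u, 0 ≤ g i u) (hb0 : ∀ e u v, 0 ≤ b e u v)
    (hb : ∀ e u u' v v', u ≤ u' → v ≤ v' → b e u' v * b e u v' ≤ b e u v * b e u' v') (x y : κ → X) :
    ((∏ i, g i (x i)) * ∏ e ∈ E, b e (x (src e)) (x (tgt e))) *
        ((∏ i, g i (y i)) * ∏ e ∈ E, b e (y (src e)) (y (tgt e))) ≤
      ((∏ i, g i ((x ⊔ y) i)) * ∏ e ∈ E, b e ((x ⊔ y) (src e)) ((x ⊔ y) (tgt e))) *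
        ((∏ i, g i ((x ⊓ y) i)) * ∏ e ∈ E, b e ((x ⊓ y) (src e)) ((x ⊓ y) (tgt e))) := by
  have h1 := mtp2_finset_prod (Finset.univ : Finset κ) (fun i x => g i (x i)) (fun i x => hg0 i _)
    (fun i x y => mtp2_of_oneBody (g i) i x y)
  have h2 := mtp2_finset_prod E (fun e x => b e (x (src e)) (x (tgt e))) (fun e x => hb0 e _ _)
    (fun e x y => mtp2_of_pairBond (b e) (hb e) (src e) (tgt e) x y)
  exact mtp2_mul (w₁ := fun x => ∏ i, g i (x i)) (w₂ := fun x => ∏ e ∈ E, b e (x (src e)) (x (tgt e)))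
    (fun x => Finset.prod_nonneg fun i _ => hg0 i _) (fun x => Finset.prod_nonneg fun e _ => hb0 e _ _)
    h1 h2 x y

/-- **HENCE EVERY PARTIAL AVERAGE OF A FERROMAGNETIC PAIR-INTERACTION WEIGHT IS MTP₂** — the numerator
`A_s w` and the denominator `A_{insert a s} w` of every exact autoregressive conditional, for every
block `s`, every order, every dimension (bounded measurable factors, any reference probability
measure). [ours] -/
theorem mtp2_coordAvg_pairBondWeight {η : Type*} [Fintype κ] [DecidableEq κ] (μ : Measure X)
    [IsProbabilityMeasure μ] (E : Finset η) (src tgt : η → κ) (b : η → X → X → ℝ) (g : κ → X → ℝ)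
    (hgm : ∀ i, Measurable (g i)) (hbm : ∀ e, Measurable (uncurry (b e)))
    (hg0 : ∀ i u, 0 ≤ g i u) (hb0 : ∀ e u v, 0 ≤ b e u v) (hgC : ∀ i, ∃ C, ∀ u, g i u ≤ C)
    (hbC : ∀ e, ∃ C, ∀ u v, b e u v ≤ C)
    (hb : ∀ e u u' v v', u ≤ u' → v ≤ v' → b e u' v * b e u v' ≤ b e u v * b e u' v')
    (s : Finset κ) (x y : κ → X) :
    let w : (κ → X) → ℝ := fun x => (∏ i, g i (x i)) * ∏ e ∈ E, b e (x (src e)) (x (tgt e))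
    coordAvg μ s w x * coordAvg μ s w y ≤ coordAvg μ s w (x ⊔ y) * coordAvg μ s w (x ⊓ y) := by
  intro w
  have hw0 : ∀ x, 0 ≤ w x := fun x =>
    mul_nonneg (Finset.prod_nonneg fun i _ => hg0 i _) (Finset.prod_nonneg fun e _ => hb0 e _ _)
  have hwm : Measurable w :=
    (Finset.measurable_prod _ fun i _ => (hgm i).comp (measurable_pi_apply i)).mul
      (Finset.measurable_prod _ fun e _ =>
        show Measurable (uncurry (b e) ∘ fun x : κ → X => (x (src e), x (tgt e))) from
          (hbm e).comp ((measurable_pi_apply _).prodMk (measurable_pi_apply _)))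
  choose Cg hCg using hgC
  choose Cb hCb using hbC
  have hwC : ∃ C, ∀ x, |w x| ≤ C := by
    refine ⟨(∏ i, Cg i) * ∏ e ∈ E, Cb e, fun x => ?_⟩
    rw [abs_of_nonneg (hw0 x)]
    exact mul_le_mul (Finset.prod_le_prod (fun i _ => hg0 i _) fun i _ => hCg i _)
      (Finset.prod_le_prod (fun e _ => hb0 e _ _) fun e _ => hCb e _ _)
      (Finset.prod_nonneg fun e _ => hb0 e _ _)
      (Finset.prod_nonneg fun i _ => (hg0 i (x i)).trans (hCg i _))
  exact mtp2_coordAvg μ s hwm hw0 hwC (fun x y => mtp2_pairBondWeight E src tgt b g hg0 hb0 hb x y) x y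

end Summit.Ventures.LatticeQCDFlow.Theory2.Autoregressive

end
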